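import Summits.SmoothPoincare4.SmoothPoincare4.Theorems.EntropyRungNoncompactShrinkerGapHeatMaxPrincipleAux
import HarnessLib

/-!
# Weak maximum principle for the weighted heat equation on a complete weighted manifold
# (crux `EntropyRung.NoncompactShrinkerGap`, stmt-SmoothPoincare4-10868, line `collapsed-ends-usc`,
# skeleton v13)

Registered helper `helper_weightedMaxPrinciple`. Setting: `M` modelled on `ℝⁿ` (Hausdorff, second
countable, T3, Borel), `g` Riemannian with its Levi-Civita connection, `V` smooth,
`L u = Δ_g u − g⁻¹(dV, du)`, weighted measure `e^{-V} dV_g`; cut-offs `η_k` (smooth, compactly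
supported, `0 ≤ η_k ≤ 1`, `η_k ≤ η_{k+1}`, eventually `= 1` near every point, `|Lη_k| ≤ C`).
**Theorem.** If `z` is smooth on `M × O` (`O ⊇ [0, T]` open), `∂ₛz ≤ L z(s,·)` on `[0,T] × M`,
`z(0,·) ≤ 0` and `z₊ e^{-V} ∈ L¹(M × (0,T))`, then `z ≤ 0` on `[0, T] × M`.

Proof (energy method with cut-offs, as in Grigor'yan 2009, §11.4 / §12.1). With the smooth convex
test function `Φ` of `exists_convexTest` (`Φ = ∫₀ smoothTransition`: `Φ = 0` on `(−∞,0]`,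
`0 ≤ Φ' ≤ 1`, `Φ'' ≥ 0`, `0 ≤ Φ(t) ≤ t₊`, `Φ(t) = 0 ⇒ t ≤ 0`) put `E_k(s) = ∫ Φ(z(s,·)) η_k e^{-V}`.
By the Leibniz rule with the compactly supported weight `η_k e^{-V}`
(`WeightedParametricIntegral.lean`) and the dissipation inequality `integral_test_dissipation_le`
(two weighted Green identities with compact support), `E_k' ≤ a_k := ∫ |Lη_k| Φ(z) e^{-V}` on
`[0, T]`; hence (FTC, `E_k(0) = 0`)
`E_k(s) ≤ ∫₀ᵀ a_k = ∫∫_{M×(0,T)} |Lη_k| Φ(z) e^{-V}` (Fubini; `g.riemVolume` is σ-finite), which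
tends to `0` by dominated convergence (`|Lη_k| Φ(z) ≤ C z₊`, `Lη_k → 0` pointwise). Since `E_k(s)`
is nondecreasing in `k` and nonnegative, every `E_k(s)` vanishes; the integrand being continuous and
nonnegative and `g.riemVolume` positive on open sets, `Φ(z(s,x)) η_k(x) = 0` for all `k, x`, and at
any `x` some `η_k(x) = 1`, so `Φ(z(s,x)) = 0`, i.e. `z(s,x) ≤ 0`.
-/

noncomputable section

set_option linter.dupNamespace false

open scoped Manifold ContDiff ENNReal NNReal Topology
open MeasureTheory Set Filter
open Literature.Geometry.Lorentzian Literature.Geometry.Riemannian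

namespace Summit.SmoothPoincare4.SmoothPoincare4.Theorems.NoncompactShrinkerGapHeat

/-! ### A smooth convex nondecreasing test function vanishing on `(-∞, 0]` -/

/-- **A smooth convex test function for the energy method.** There is `Φ : ℝ → ℝ` of class
`C^∞`, vanishing on `(-∞, 0]`, with `0 ≤ Φ' ≤ 1`, `Φ'' ≥ 0`, `0 ≤ Φ(t) ≤ t₊` and `Φ(t) = 0` only
for `t ≤ 0`: the primitive `Φ(t) = ∫₀ᵗ ψ` of Mathlib's smooth transition `ψ = Real.smoothTransition`
(`ψ = 0` on `(-∞, 0]`, `0 < ψ ≤ 1` on `(0, ∞)`, `ψ` monotone). [folklore] -/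
theorem exists_convexTest : ∃ Φ : ℝ → ℝ, ContDiff ℝ ∞ Φ ∧ (∀ t ≤ 0, Φ t = 0) ∧
    (∀ t, 0 ≤ deriv Φ t ∧ deriv Φ t ≤ 1) ∧ (∀ t, 0 ≤ deriv (deriv Φ) t) ∧
    (∀ t, 0 ≤ Φ t ∧ Φ t ≤ max t 0) ∧ (∀ t, Φ t = 0 → t ≤ 0) := by
  set Φ : ℝ → ℝ := fun t ↦ ∫ x in (0 : ℝ)..t, Real.smoothTransition x with hΦ
  have hc : Continuous Real.smoothTransition := Real.smoothTransition.continuous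
  have hd : deriv Φ = Real.smoothTransition := by
    funext t
    exact hc.deriv_integral _ 0 t
  have hdiff : Differentiable ℝ Φ := fun t ↦
    (hc.integral_hasStrictDerivAt 0 t).hasDerivAt.differentiableAt
  have hsmooth : ContDiff ℝ ∞ Φ := by
    rw [contDiff_infty_iff_deriv, hd]
    exact ⟨hdiff, Real.smoothTransition.contDiff⟩
  have hneg : ∀ t ≤ 0, Φ t = 0 := by
    intro t ht
    show ∫ x in (0 : ℝ)..t, Real.smoothTransition x = 0
    rw [intervalIntegral.integral_congr (g := fun _ ↦ (0 : ℝ)) ?_, intervalIntegral.integral_zero]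
    intro x hx
    rw [uIcc_of_ge ht] at hx
    exact Real.smoothTransition.zero_of_nonpos hx.2
  refine ⟨Φ, hsmooth, hneg, ?_, ?_, ?_, ?_⟩
  · intro t
    rw [hd]
    exact ⟨Real.smoothTransition.nonneg t, Real.smoothTransition.le_one t⟩
  · intro t
    rw [hd]
    exact Real.smoothTransition.monotone.deriv_nonneg
  · intro t
    rcases le_or_gt t 0 with ht | ht
    · rw [hneg t ht]
      exact ⟨le_rfl, le_max_right _ _⟩
    · refine ⟨intervalIntegral.integral_nonneg ht.le fun x _ ↦ Real.smoothTransition.nonneg x, ?_⟩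
      calc Φ t ≤ ∫ _ in (0 : ℝ)..t, (1 : ℝ) :=
            intervalIntegral.integral_mono_on ht.le (hc.intervalIntegrable _ _)
              intervalIntegrable_const (fun x _ ↦ Real.smoothTransition.le_one x)
        _ = t := by simp
        _ ≤ max t 0 := le_max_left _ _
  · intro t h
    by_contra hlt
    have hlt' : 0 < t := lt_of_not_ge hlt
    have hpos : 0 < Φ t := intervalIntegral.intervalIntegral_pos_of_pos_on
      (hc.intervalIntegrable _ _) (fun x hx ↦ Real.smoothTransition.pos_of_pos hx.1) hlt'
    exact hpos.ne' h

/-! ### The weighted maximum principle -/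

/-- **Weak maximum principle for subsolutions of the weighted heat equation on a complete
weighted manifold, in the class `z₊ e^{-V} ∈ L¹(M × (0,T))`** (registered helper
`helper_weightedMaxPrinciple` of line `collapsed-ends-usc`). Energy method with cut-offs: for the
convex test function `Φ` of `exists_convexTest` and `E_k(s) = ∫ Φ(z(s,·)) η_k e^{-V}`, the Leibniz
rule (compactly supported weight) and the dissipation inequality `integral_test_dissipation_le` give
`E_k' ≤ ∫ |Lη_k| Φ(z) e^{-V}` on `[0, T]`, whence `0 ≤ E_k(s) ≤ ∫∫_{M×(0,T)} |Lη_k| Φ(z) e^{-V} → 0`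
(`E_k(0) = 0`, `|Lη_k| ≤ C`, `Lη_k → 0` pointwise, `Φ(z) ≤ z₊`, dominated convergence); as `E_k` is
nondecreasing in `k`, every `E_k(s)` vanishes, so `Φ(z(s,·)) η_k = 0` and `z(s, x) ≤ 0` wherever
some `η_k(x) = 1`. [cite: Grigoryan2009, §11.4 and §12.1 (uniqueness class and integrated maximum
principle for the Cauchy problem on complete weighted manifolds, energy estimates with cut-offs)] -/
theorem helper_weightedMaxPrinciple : ∀ (n : ℕ) (M : Type*) [TopologicalSpace M] [T2Space M] [SecondCountableTopology M] [ChartedSpace (EuclideanSpace ℝ (Fin n)) M] [IsManifold (𝓡 n) ∞ M] [T3Space M] [MeasurableSpace M] [BorelSpace M] (g : PseudoRiemannianMetric (𝓡 n) ∞ (EuclideanSpace ℝ (Fin n)) (TangentSpace (𝓡 n) : M → Type _)) [g.HasLeviCivita] (V : M → ℝ), g.IsRiemannian → ContMDiff (𝓡 n) 𝓘(ℝ, ℝ) ∞ V → ∀ (η : ℕ → M → ℝ) (C : ℝ), (∀ k, ContMDiff (𝓡 n) 𝓘(ℝ, ℝ) ∞ (η k)) → (∀ k, HasCompactSupport (η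 k)) → (∀ k x, 0 ≤ η k x ∧ η k x ≤ 1) → (∀ k x, η k x ≤ η (k + 1) x) → (∀ x, ∀ᶠ k in atTop, ∀ᶠ y in 𝓝 x, η k y = 1) → (∀ k x, |g.dalembertian (η k) x - g.innerDual x (mvfderiv (𝓡 n) V x).toLinearMap (mvfderiv (𝓡 n) (η k) x).toLinearMap| ≤ C) → ∀ (T : ℝ) (O : Set ℝ) (z : ℝ → M → ℝ), 0 < T → IsOpen O → Icc 0 T ⊆ O → ContMDiffOn ((𝓡 n).prod 𝓘(ℝ, ℝ)) 𝓘(ℝ, ℝ) ∞ (fun p : M × ℝ ↦ z p.2 p.1) (univ ×ˢ O) → (∀ s ∈ Icc 0 T, ∀ x, deriv (fun r ↦ z r x) s ≤ g.dalembertian (z s) x - g.innerDual x (mvfderiv (𝓡 n) V x).toLinearMap (mvfderiv (𝓡 n) (z s) x).toLinearMap) → (∀ x, z 0 x ≤ 0) → Integrable (fun p : M × ℝ ↦ max (z p.2 p.1) 0 * Real.exp (-V p.1)) ((g.riemVolume.prod (volume : Measure ℝ)).restrict (univ ×ˢ Ioo 0 T)) → ∀ s ∈ Icc 0 T, ∀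 x, z s x ≤ 0 := by
  intro n M _ _ _ _ _ _ _ _ g _ V hg hV η C hηs hηc hη01 hηmono hη1 hLη T O z hT hO hTO hz hsub
    hz0 hint s₀ hs₀ x₀
  -- topology and measure
  haveI : LocallyCompactSpace M := Manifold.locallyCompact_of_finiteDimensional (M := M) (𝓡 n)
  haveI : IsFiniteMeasureOnCompacts g.riemVolume :=
    CarrilloNi2009_shrinkerLSI.isFiniteMeasureOnCompacts_riemVolume hg
  haveI : IsLocallyFiniteMeasure g.riemVolume := isLocallyFiniteMeasure_of_isFiniteMeasureOnCompacts
  haveI : g.riemVolume.IsOpenPosMeasure := by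
    rw [PseudoRiemannianMetric.riemVolume_eq hg]; exact isOpenPosMeasure_riemannianMeasure _
  set μ : Measure M := g.riemVolume with hμ
  -- the test function
  obtain ⟨Φ, hΦs, hΦneg, hΦ', hΦ'', hΦbd, hΦzero⟩ := exists_convexTest
  have hΦd : ∀ t, HasDerivAt Φ (deriv Φ t) t := fun t ↦ (hΦs.differentiable (by simp) t).hasDerivAt
  have hΦc : Continuous Φ := hΦs.continuous
  have hΦ'c : Continuous (deriv Φ) := hΦs.continuous_deriv (by simp)
  -- the weighted Laplacians `ℓ k = Lη_k` of the cut-offs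
  set ℓ : ℕ → M → ℝ := fun k x ↦ g.dalembertian (η k) x -
    g.innerDual x (mvfderiv (𝓡 n) V x).toLinearMap (mvfderiv (𝓡 n) (η k) x).toLinearMap with hℓ
  have hℓc : ∀ k, Continuous (ℓ k) := fun k ↦
    (continuous_hasCompactSupport_weightedLaplacian (g := g) (hηs k) (hηc k) hV).1
  have hℓs : ∀ k, HasCompactSupport (ℓ k) := fun k ↦
    (continuous_hasCompactSupport_weightedLaplacian (g := g) (hηs k) (hηc k) hV).2
  have hC0 : 0 ≤ C := (abs_nonneg _).trans (hLη 0 x₀)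
  have hℓ0 : ∀ x, ∀ᶠ k in atTop, ℓ k x = 0 := fun x ↦ (hη1 x).mono fun k hk ↦
    weightedLaplacian_eq_zero_of_eventuallyEq_one (g := g) (V := V) (hηs k) hk
  -- regularity of `z`: slices, joint continuity, time derivative
  have hexpc : Continuous fun x ↦ Real.exp (-V x) := Real.continuous_exp.comp hV.continuous.neg
  have hzs : ∀ s ∈ O, ContMDiff (𝓡 n) 𝓘(ℝ, ℝ) ∞ (z s) := fun s hs ↦
    contMDiff_slice_of_contMDiffOn hz hs
  have hswap : ∀ p ∈ O ×ˢ (univ : Set M), (Prod.swap p) ∈ (univ : Set M) ×ˢ O :=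
    fun p hp ↦ ⟨mem_univ _, hp.1⟩
  have hzc : ContinuousOn (fun p : ℝ × M ↦ z p.1 p.2) (O ×ˢ univ) :=
    hz.continuousOn.comp continuous_swap.continuousOn hswap
  have hdz : ContMDiffOn ((𝓡 n).prod 𝓘(ℝ, ℝ)) 𝓘(ℝ, ℝ) ∞
      (fun p : M × ℝ ↦ deriv (fun r ↦ z r p.1) p.2) (univ ×ˢ O) := by
    have h := contMDiffOn_derivWithin_time_of_uniqueDiffOn (I := 𝓡 n) (u := z) hO.uniqueDiffOn hz
    exact h.congr fun p hp ↦ (derivWithin_of_isOpen hO hp.2).symm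
  have hzd : ∀ s ∈ O, ∀ x, HasDerivAt (fun r ↦ z r x) (deriv (fun r ↦ z r x) s) s := by
    intro s hs x
    have h := hasDerivWithinAt_time_of_contMDiffOn (I := 𝓡 n) (k := ∞) (by simp) hz x hs
    exact (h.hasDerivAt (hO.mem_nhds hs)).differentiableAt.hasDerivAt
  have hdzc : ContinuousOn (fun p : ℝ × M ↦ deriv (fun r ↦ z r p.2) p.1) (O ×ˢ univ) :=
    hdz.continuousOn.comp continuous_swap.continuousOn hswap
  -- the integrands `F = Φ(z)`, `F' = Φ'(z) ∂ₛz`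
  set F : ℝ → M → ℝ := fun s x ↦ Φ (z s x) with hF
  set F' : ℝ → M → ℝ := fun s x ↦ deriv Φ (z s x) * deriv (fun r ↦ z r x) s with hF'
  have hFc : ContinuousOn (Function.uncurry F) (O ×ˢ univ) := hΦc.comp_continuousOn hzc
  have hF'c : ContinuousOn (Function.uncurry F') (O ×ˢ univ) :=
    (hΦ'c.comp_continuousOn hzc).mul hdzc
  have hFd : ∀ s ∈ O, ∀ x, HasDerivAt (F · x) (F' s x) s := fun s hs x ↦
    (hΦd (z s x)).comp s (hzd s hs x)
  have hFsc : ∀ s ∈ O, Continuous (F s) := fun s hs ↦ hΦc.comp (hzs s hs).continuous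
  have hF'sc : ∀ s ∈ O, Continuous (F' s) := fun s hs ↦
    hF'c.comp_continuous (Continuous.prodMk_right s) fun x ↦ ⟨hs, mem_univ _⟩
  -- the weights `h k = η_k e^{-V}`, energies `E k`, derivatives `E' k`, dissipation bounds `a k`
  set h : ℕ → M → ℝ := fun k x ↦ η k x * Real.exp (-V x) with hh
  have hhc : ∀ k, Continuous (h k) := fun k ↦ (hηs k).continuous.mul hexpc
  have hhs : ∀ k, HasCompactSupport (h k) := fun k ↦ (hηc k).mul_right
  have hh0 : ∀ k x, 0 ≤ h k x := fun k x ↦ mul_nonneg (hη01 k x).1 (Real.exp_pos _).le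
  set E : ℕ → ℝ → ℝ := fun k s ↦ ∫ x, h k x • F s x ∂μ with hE
  set E' : ℕ → ℝ → ℝ := fun k s ↦ ∫ x, h k x • F' s x ∂μ with hE'
  set a : ℕ → ℝ → ℝ := fun k s ↦ ∫ x, (|ℓ k x| * Real.exp (-V x)) • F s x ∂μ with ha
  have hEd : ∀ k, ∀ s ∈ O, HasDerivAt (E k) (E' k s) s := fun k s hs ↦
    Literature.Analysis.FluidPDE.hasDerivAt_integral_smul_of_continuousOn (hhc k) (hhs k) hO hFc
      hF'c hFd hs
  have hE'c : ∀ k, ContinuousOn (E' k) O := fun k ↦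
    Literature.Analysis.FluidPDE.continuousOn_integral_smul_of_continuousOn (hhc k) (hhs k) hF'c
  have hℓec : ∀ k, Continuous fun x ↦ |ℓ k x| * Real.exp (-V x) := fun k ↦ (hℓc k).abs.mul hexpc
  have hℓes : ∀ k, HasCompactSupport fun x ↦ |ℓ k x| * Real.exp (-V x) := fun k ↦
    ((hℓs k).comp_left (g := fun t : ℝ ↦ |t|) abs_zero).mul_right
  have hac : ∀ k, ContinuousOn (a k) O := fun k ↦
    Literature.Analysis.FluidPDE.continuousOn_integral_smul_of_continuousOn (hℓec k) (hℓes k) hFc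
  have ha0 : ∀ k s, 0 ≤ a k s := fun k s ↦ integral_nonneg fun x ↦
    mul_nonneg (mul_nonneg (abs_nonneg _) (Real.exp_pos _).le) (hΦbd _).1
  -- the dissipation bound `E' ≤ a` on `[0, T]`
  have hE'le : ∀ k, ∀ s ∈ Icc 0 T, E' k s ≤ a k s := by
    intro k s hs
    have hsO := hTO hs
    have hws := hzs s hsO
    have hLc : Continuous fun x ↦ g.dalembertian (z s) x -
        g.innerDual x (mvfderiv (𝓡 n) V x).toLinearMap (mvfderiv (𝓡 n) (z s) x).toLinearMap :=
      (continuous_dalembertian g (hws.of_le (WithTop.coe_le_coe.mpr le_top))).sub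
        (continuous_innerDual_mvfderiv g (hV.of_le (by norm_num)) (hws.of_le (by norm_num)))
    have i1 : Integrable (fun x ↦ h k x • F' s x) μ :=
      ((hhc k).smul (hF'sc s hsO)).integrable_of_hasCompactSupport ((hhs k).smul_right)
    have i2 : Integrable (fun x ↦ h k x • (deriv Φ (z s x) * (g.dalembertian (z s) x -
        g.innerDual x (mvfderiv (𝓡 n) V x).toLinearMap (mvfderiv (𝓡 n) (z s) x).toLinearMap))) μ :=
      ((hhc k).smul ((hΦ'c.comp hws.continuous).mul hLc)).integrable_of_hasCompactSupport
        ((hhs k).smul_right)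
    have step1 : E' k s ≤ ∫ x, h k x • (deriv Φ (z s x) * (g.dalembertian (z s) x -
        g.innerDual x (mvfderiv (𝓡 n) V x).toLinearMap (mvfderiv (𝓡 n) (z s) x).toLinearMap))
        ∂μ := by
      refine integral_mono i1 i2 fun x ↦ ?_
      exact mul_le_mul_of_nonneg_left (mul_le_mul_of_nonneg_left (hsub s hs x) (hΦ' _).1) (hh0 k x)
    have step2 := integral_test_dissipation_le hg hws (hηs k) (hηc k) (fun x ↦ (hη01 k x).1) hV hΦs
      (fun t ↦ (hΦbd t).1) hΦ''
    exact step1.trans step2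
  -- integrating in time: `E k s₀ ≤ ∫₀ᵀ a k`
  have hEbound : ∀ k, E k s₀ ≤ ∫ s in (0 : ℝ)..T, a k s := by
    intro k
    have hIcc : Icc 0 s₀ ⊆ O := fun s hs ↦ hTO ⟨hs.1, hs.2.trans hs₀.2⟩
    have hderiv : ∀ s ∈ uIcc 0 s₀, HasDerivAt (E k) (E' k s) s := by
      intro s hs
      rw [uIcc_of_le hs₀.1] at hs
      exact hEd k s (hIcc hs)
    have hE'i : IntervalIntegrable (E' k) volume 0 s₀ :=
      ((hE'c k).mono (by rw [uIcc_of_le hs₀.1]; exact hIcc)).intervalIntegrable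
    have hai : IntervalIntegrable (a k) volume 0 T :=
      ((hac k).mono (by rw [uIcc_of_le hT.le]; exact hTO)).intervalIntegrable
    have hai' : IntervalIntegrable (a k) volume 0 s₀ :=
      ((hac k).mono (by rw [uIcc_of_le hs₀.1]; exact hIcc)).intervalIntegrable
    have hFTC := intervalIntegral.integral_eq_sub_of_hasDerivAt hderiv hE'i
    have hE0 : E k 0 = 0 := by
      refine integral_eq_zero_of_ae (ae_of_all _ fun x ↦ ?_)
      simp [hF, hΦneg _ (hz0 x)]
    calc E k s₀ = ∫ s in (0 : ℝ)..s₀, E' k s := by rw [hFTC, hE0, sub_zero]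
      _ ≤ ∫ s in (0 : ℝ)..s₀, a k s := intervalIntegral.integral_mono_on hs₀.1 hE'i hai'
          fun s hs ↦ hE'le k s ⟨hs.1, hs.2.trans hs₀.2⟩
      _ ≤ ∫ s in (0 : ℝ)..T, a k s := intervalIntegral.integral_mono_interval le_rfl hs₀.1 hs₀.2
          (ae_restrict_of_forall_mem measurableSet_Ioc fun s _ ↦ ha0 k s) hai
  -- the strip integrals and their limit
  set ν : Measure (M × ℝ) := (μ.prod (volume : Measure ℝ)).restrict (univ ×ˢ Ioo 0 T) with hν
  set G : ℕ → M × ℝ → ℝ := fun k p ↦ (|ℓ k p.1| * Real.exp (-V p.1)) • F p.2 p.1 with hG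
  have hνeq : ν = μ.prod ((volume : Measure ℝ).restrict (Ioo 0 T)) := by
    rw [hν, ← Measure.prod_restrict, Measure.restrict_univ]
  have hGm : ∀ k, AEStronglyMeasurable (G k) ν := by
    intro k
    have hcont : ContinuousOn (G k) (univ ×ˢ O) := by
      refine ((((hℓc k).abs.mul hexpc).comp continuous_fst).continuousOn).smul ?_
      exact hΦc.comp_continuousOn hz.continuousOn
    exact (hcont.mono (prod_mono le_rfl (Ioo_subset_Icc_self.trans hTO))).aestronglyMeasurable
      (MeasurableSet.univ.prod measurableSet_Ioo)
  have hGbd : ∀ k p, ‖G k p‖ ≤ C * (max (z p.2 p.1) 0 * Real.exp (-V p.1)) := by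
    intro k p
    have h1 := hLη k p.1
    have h2 := (hΦbd (z p.2 p.1)).2
    have h3 := (hΦbd (z p.2 p.1)).1
    have hex := Real.exp_pos (-V p.1)
    rw [Real.norm_eq_abs, hG]
    simp only [smul_eq_mul]
    rw [abs_of_nonneg (mul_nonneg (mul_nonneg (abs_nonneg _) hex.le) h3)]
    calc |ℓ k p.1| * Real.exp (-V p.1) * Φ (z p.2 p.1)
        ≤ C * Real.exp (-V p.1) * max (z p.2 p.1) 0 := by gcongr
      _ = C * (max (z p.2 p.1) 0 * Real.exp (-V p.1)) := by ring
  have hGi : ∀ k, Integrable (G k) ν := fun k ↦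
    (hint.const_mul C).mono' (hGm k) (ae_of_all _ (hGbd k))
  have hstrip : ∀ k, ∫ s in (0 : ℝ)..T, a k s = ∫ p, G k p ∂ν := by
    intro k
    rw [intervalIntegral.integral_of_le hT.le, integral_Ioc_eq_integral_Ioo, hνeq,
      integral_prod_symm (G k) (by rw [← hνeq]; exact hGi k)]
  have hlim : Tendsto (fun k ↦ ∫ p, G k p ∂ν) atTop (𝓝 0) := by
    have h := tendsto_integral_of_dominated_convergence (F := G) (f := fun _ ↦ (0 : ℝ))
      (fun p ↦ C * (max (z p.2 p.1) 0 * Real.exp (-V p.1))) hGm (hint.const_mul C)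
      (fun k ↦ ae_of_all _ (hGbd k)) (ae_of_all _ fun p ↦ ?_)
    · simpa using h
    · refine tendsto_const_nhds.congr' ?_
      filter_upwards [hℓ0 p.1] with k hk
      simp [hG, hk]
  -- every energy vanishes at `s₀`
  have hs₀O := hTO hs₀
  have hEi : ∀ k, Integrable (fun x ↦ h k x • F s₀ x) μ := fun k ↦
    ((hhc k).smul (hFsc s₀ hs₀O)).integrable_of_hasCompactSupport ((hhs k).smul_right)
  have hEmono : ∀ k j, k ≤ j → E k s₀ ≤ E j s₀ := by
    intro k j hkj
    refine integral_mono (hEi k) (hEi j) fun x ↦ ?_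
    have hηle : η k x ≤ η j x := (monotone_nat_of_le_succ fun m ↦ hηmono m x) hkj
    exact mul_le_mul_of_nonneg_right (mul_le_mul_of_nonneg_right hηle (Real.exp_pos _).le)
      (hΦbd _).1
  have hEzero : ∀ k, E k s₀ = 0 := by
    intro k
    refine le_antisymm ?_ (integral_nonneg fun x ↦ mul_nonneg (hh0 k x) (hΦbd _).1)
    have hb : Tendsto (fun j ↦ ∫ s in (0 : ℝ)..T, a j s) atTop (𝓝 0) := by
      simp only [hstrip]; exact hlim
    exact ge_of_tendsto hb (eventually_atTop.2 ⟨k, fun j hj ↦ (hEmono k j hj).trans (hEbound j)⟩)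
  -- conclusion at `x₀`
  obtain ⟨k, hk⟩ := (hη1 x₀).exists
  have hk1 : η k x₀ = 1 := hk.self_of_nhds
  have hcont : Continuous fun x ↦ h k x • F s₀ x := (hhc k).smul (hFsc s₀ hs₀O)
  have hnn : 0 ≤ fun x ↦ h k x • F s₀ x := fun x ↦ mul_nonneg (hh0 k x) (hΦbd _).1
  have hae := (integral_eq_zero_iff_of_nonneg hnn (hEi k)).1 (hEzero k)
  have heq := (hcont.ae_eq_iff_eq μ continuous_const).1 hae
  have hx : h k x₀ * F s₀ x₀ = 0 := congr_fun heq x₀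
  have hpos : 0 < h k x₀ := by simp only [hh, hk1, one_mul]; exact Real.exp_pos _
  have hΦ0 : Φ (z s₀ x₀) = 0 := by
    rcases mul_eq_zero.1 hx with h0 | h0
    · exact absurd h0 hpos.ne'
    · exact h0
  exact hΦzero _ hΦ0

end Summit.SmoothPoincare4.SmoothPoincare4.Theorems.NoncompactShrinkerGapHeat

end
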